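import Summits.QuantumFields.YangMills.Theorems.BalabanUVNodesN11Thm1PrintedAtCRLetteredMemberOfBgFacts

/-!
# DAG node N11 — «γ SUFFICIENTLY SMALL» QUANTIFIED FOR THE CAPSTONE AT THE cR-LETTERED MEMBER ON THE GUARD-FREE bg ROAD: N11's printed face `B16.Thm1Printed` at `gaussPinH θ` for
# EVERY member `c ∈ [2, 8]` and EVERY window letter `γ ∈ ]0, γ₁₁ⁿᵘᵐ(L, j, N)]` — generic key, and at the member's history-blind door KEY INCLUDED

HEADER — WORK-UNIT METADATA.  Cell `pub-ymgap`, YM-PLAN Track A (HUMAN RULING D-0062 ∕ D-0149 width seats), seat `pub-ymgap-dag-n11-w3` (g5; WIDTH SEAT 3∕4 on NODE n11 [B14]),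
route `BalabanUVNodes` rev 29, item K1⁹ `StabilityBRunRowsAtRecordR13SepCoPHV` = stmt-QuantumFields-27364 (helper lane `--kind proof --supports 27364 --as helper`, count-neutral).
The desk-worded sequel of dag-lead DEDUP-394 (1) (pub-ymgap INBOX 2026-08-28 I.36868): dag-n11-w5 g2 files the capstone (p631153 `…N11Thm1PrintedAtCRLetteredMemberOfBgFacts`:
★★★★★ `thm1Printed_gaussPinH_ccmwCRH_of_supplierBorel_of_solvable_of_hjm`, ★★★★★ `thm1Printed_gaussPinH_door_ccmwCR_of_supplierBorel_of_solvable_of_hjm`), this seat quantifies its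
window letter with g3's p608030 `exists_window_ccmShape` (`γ₁₁ⁿᵘᵐ(L, j, N) := min (e^{−(3L^j + 8L + 3)}) ((c′∕4)²)`, `c′ := min (16∕(3·36608)) (16δ_N∕(8L)²)`).
[III] = [Balaban1988Convergent], [15] = [Balaban1985Variational], [I] = [Balaban1987RG1], [IV] = [Balaban1989LargeFieldI], [V] = [Balaban1989LargeFieldII].

WHY THIS FILE.  The capstone's γ-side binders are `0 < γ ≤ e^{−1}` and the four γ-conditions of the numeric rows (`3·L^j ≤ L·log γ⁻²`, `8L + 3 ≤ L·log γ⁻²`, `36608·γ·log γ⁻² ≤ 16∕3`,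
`γ·log γ⁻² ≤ 16·δ_N∕(8L)²`); print says only «γ sufficiently small» ([I] Thm 1 p.259).  All five hold on `]0, γ₁₁ⁿᵘᵐ(L, j, N)]` (p608030 §1), so the capstone holds for EVERY `γ` in
that interval — the form a K1-road consumer quantifying over the window letter reads.

WHAT THIS FILE PROVES (2 theorems, 0 `def`, 0 `sorry`; standard axioms; one application each after `exists_window_ccmShape`).
★★★★ `exists_window_thm1Printed_gaussPinH_ccmwCRH_of_betaBox` (generic key) · ★★★★ `exists_window_thm1Printed_gaussPinH_door_ccmwCR_of_betaBox` (door, key included).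

HONEST FRAMING ∕ A6.  Helper lane, count-neutral KERNEL BOOKKEEPING; nothing of Bałaban asserted.  DISPLAYED (hypotheses, NOT discharged, inhabited nowhere in the tree): (8)
`VariationalThm1RegSepCoP7M`, the (9)-step `Gauge9RegSepTopStepR`, the sign-free windowed β-box (`−bₗ·γ² ≤ 3`, `β′·γ² ≤ ¾`), K0's per-cube [15]-solvability along the windowed runs,
[III] §3's supplier (`SupplierObligations ∧ SupplierBorel`) on the windowed runs, and (generic edition) the key.  Non-wrapping families only (`j + 1 ≤ F.m`); `c ∈ [2, 8]`.  NOT a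
re-pin (no `def`); N11 NOT discharged; K0⁷ ∕ K1⁹ NOT closed, no stub touched; counts unmoved (typed 28∕28 · discharged 5∕27 · A 5∕28).  One finite `𝕋⁴_{L^K}` programme at fixed
`ε = L^{−K}`; `route-QuantumFields-BalabanUVNodes` closes ONLY the CONDITIONAL finite-𝕋⁴ rung `BalabanLadder.UV` — NOT ℝ⁴, NOT OS, NOT the Yang–Mills mass gap (Clay).  No `sorry`,
no `axiom`, no `def`, no `instance`, no `notation`.
Sources (SHAPE only): [III] Thm 1 p.262, Theorem p.245, §3 p.279, (2.4)–(2.5) p.255, (2.10) p.256, (2.28) p.259, (3.16)–(3.25) pp.268–270; [15] Thm 1 (7)–(9) pp.278–279, (144)–(152)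
pp.300–301; [I] Thm 1 p.259, (0.20) p.256, (1.20)–(1.22) p.264; [IV] (0.2)–(0.4) p.176; [V] Thm 1 p.355.
-/

noncomputable section

open MeasureTheory
open scoped BigOperators ENNReal NNReal Matrix.Norms.L2Operator

namespace Summit.QuantumFields.YangMills.Theorems.BalabanUVNodesN11Thm1PrintedAtCRLetteredMemberOfBgFactsWindow

open Literature.MathematicalPhysics.QuantumFieldTheory.Balaban1983to89 T4Continuum T4NestedCovariance Node00 Node00.Tk DagBinding
open B15DeterminingSets B8Eq17ClassAkV1 B14.Eq218Concrete B10Eq42TorusConstraint FlowStep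
open B14.Eq213DetSet (Bj)
open Literature.MathematicalPhysics.QuantumFieldTheory.BalabanImbrieJaffe1984to88.BIJ85Eq453GaugeField (qsstarGIter0)
open BalabanUVNodesN11HistoryPinnedResidualDefs BalabanUVNodesN11RePinnedParamDefs
open BalabanUVNodesN11GaussianCertificateDefs (gaussPinH)
open BalabanUVNodesN11Sect3SupplyChainDefs
open BalabanUVNodesN11Sect3SupplyChainBorelB
open BalabanUVNodesN11Sect3SupplyChainObligationsDefs
open BalabanUVNodesN11Sect3SupplyChainBorelBThm1PrintedOfSolvable (provisos₁₃SepCoPH_gaussPinH)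
open BalabanUVNodesN11K0DoorAtCRLetteredNumerics (provisos₁₃SepCoPH_door_ccmwCR_of_gauge9TopStepR_of_betaBoxSignFree_allTorus)
open BalabanUVNodesN11Thm1PrintedAtCRLetteredMemberOfBgFacts
open BalabanUVNodesN11NoExpansionNumericsAtThm1CCMW (exists_window_ccmShape)

variable (F : T4Family) (N : ℕ) [NeZero N] {j : ℕ}

/-- **★★★★ «γ SUFFICIENTLY SMALL» QUANTIFIED — N11's PRINTED OUTPUT AT `gaussPinH θ` ON THE GUARD-FREE bg ROAD AT EVERY cR-LETTERED MEMBER `c ∈ [2, 8]`, EVERY WINDOW LETTER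
`γ ∈ ]0, γ₁₁ⁿᵘᵐ(L, j, N)]`, GENERIC KEY** (`1 ≤ j`, `j + 1 ≤ F.m`): there is an explicit `γ₁₁ⁿᵘᵐ > 0` (p608030 §1) such that for every such `γ`, `c`, [15]'s signs, (8), the (9)-step,
the sign-free β-box of `betaOfRecord₁₃ F N θ₁₅ᶜᶜᴹᵂ(j; γ)`, every H-extension `θ` of `θ₁₃(n_c, ε₂₉)` with the key, K0's per-cube [15]-solvability and a [III] §3 supplier on the windowed runs,
`B16.Thm1Printed (datumOfRecord₁₃SepCoPH F N (gaussPinH θ) _).C` — dag-n11-w5's ★★★★★ `thm1Printed_gaussPinH_ccmwCRH_of_supplierBorel_of_solvable_of_hjm` with its five γ-conditions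
supplied by `exists_window_ccmShape`.  CONDITIONAL; nothing of Bałaban asserted.
[cite: Balaban1988Convergent, Thm 1 p.262, Theorem p.245, §3 p.279, (2.4)–(2.5) p.255, (2.10) p.256, (2.28) p.259; Balaban1987RG1, Thm 1 p.259 («contained in an interval ]0, γ] with a sufficiently small positive γ»), (0.20) p.256, (1.20)–(1.22) p.264; Balaban1989LargeFieldII, Thm 1 p.355; Balaban1989LargeFieldI, (0.3)–(0.4) p.176; Balaban1985Variational, Thm 1 (7)–(9) pp.278–279, (144)–(152) pp.300–301] -/
theorem exists_window_thm1Printed_gaussPinH_ccmwCRH_of_betaBox (hj : 1 ≤ j) (hjm : j + 1 ≤ F.m) :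
    ∃ γ₀ : ℝ, 0 < γ₀ ∧ ∀ (γ c ε₀ ε₂₉ B₃ B₃' a₀ a₁ bl β' : ℝ) (c₁₅ : ℕ), 2 ≤ c → c ≤ 8 → 0 < ε₀ → 0 < ε₂₉ → 0 ≤ B₃ → 0 ≤ B₃' → 0 < a₀ → 0 < a₁ → 0 < γ → γ ≤ γ₀ →
      VariationalThm1RegSepCoP7M F N B₃ a₀ a₁ → c₁₅ ≤ F.L ^ j → Gauge9RegSepTopStepR F N (fun ν K Ω => suppDomOfRecord F ν K Ω) (F.L ^ j) c₁₅ B₃ B₃' a₀ a₁ →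
      BetaLowerH bl γ (betaOfRecord₁₃ F N (theta13OfThm1CCMW F N j γ ε₀ ε₂₉ B₃ B₃' a₀ a₁)) →
      BetaUpperH β' γ (betaOfRecord₁₃ F N (theta13OfThm1CCMW F N j γ ε₀ ε₂₉ B₃ B₃' a₀ a₁)) → -bl * γ ^ 2 ≤ 3 → β' * γ ^ 2 ≤ 3 / 4 →
      ∀ (θ : Stage13HParams F N), θ.toStage13Params = theta13LiveOfNumerics F N
          ({ stage12NumericsOfThm1CCMW F.L j γ ε₀ B₃ B₃' a₀ a₁ with s2 := { sect2NumericsOfThm1C F.L with cR := c } } : Stage12Numerics) ε₂₉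
          (zeta316OfRecord F N (stage12NumericsOfThm1CCMW F.L j γ ε₀ B₃ B₃' a₀ a₁).ν (stage12NumericsOfThm1CCMW F.L j γ ε₀ B₃ B₃' a₀ a₁).τ9.M
            (stage12NumericsOfThm1CCMW F.L j γ ε₀ B₃ B₃' a₀ a₁).A₁) (RzOfRecord F N) (ZtOfRecord F N) →
      ∀ (h : θ.Provisos₁₃SepCoPH F N),
      (∀ P : B12.RunParams, Step.InInterval γ P.K (gOfRecord₁₃ F N θ.toStage13Params P) → ∀ i, 1 ≤ i → i ≤ P.K →
        ∀ (s : SeqOfRecord F θ.toStage13Params.ν θ.toStage13Params.τ9.M (gOfRecord₁₃ F N θ.toStage13Params P) P.K i) (V : GaugeField (F.P P.K) i (SU N)),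
        chiSeqOfRecord F N θ.toStage13Params.ν θ.toStage13Params.τ9.M (gOfRecord₁₃ F N θ.toStage13Params P) P.K i s V ≠ 0 →
        ∀ a ∈ cubesIn (fun a : ↥(cubeIndices (F.P P.K) (cubeSide (F.P P.K).L θ.toStage13Params.ν.M₂ (RkOfRecord (F.P P.K).L θ.toStage13Params.ν.r (gOfRecord₁₃ F N θ.toStage13Params P i)) i)) =>
            cubeEnl (F.P P.K) (cubeSide (F.P P.K).L θ.toStage13Params.ν.M₂ (RkOfRecord (F.P P.K).L θ.toStage13Params.ν.r (gOfRecord₁₃ F N θ.toStage13Params P i)) i) a 0) (s.Ω i),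
          ∃ U₀, IsMinimizer (avOfRecord F N P.K) {U | PlaqSmall (θ.toStage13Params.ν.εreg * (F.P P.K).eta i ^ 2) U}
            (Bj θ.toStage13Params.ν.M₁ (cubeEnl (F.P P.K) (cubeSide (F.P P.K).L θ.toStage13Params.ν.M₂ (RkOfRecord (F.P P.K).L θ.toStage13Params.ν.r (gOfRecord₁₃ F N θ.toStage13Params P i)) i) a 4) i)
            (avgFamily (avOfRecord F N P.K) (qsstarGIter0 i V)) U₀) →
      ∀ (σ : (P : B12.RunParams) → Sect3Supplier (gaussPinH θ) P),
      (∀ P : B12.RunParams, Step.InInterval γ P.K (gOfRecord₁₃ F N θ.toStage13Params P) → SupplierObligations (gaussPinH θ) P (σ P)) →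
      (∀ P : B12.RunParams, Step.InInterval γ P.K (gOfRecord₁₃ F N θ.toStage13Params P) → SupplierBorel (gaussPinH θ) P (σ P)) →
      B16.Thm1Printed (datumOfRecord₁₃SepCoPH F N (gaussPinH θ) (provisos₁₃SepCoPH_gaussPinH h)).C := by
  obtain ⟨γ₀, hγ₀, hall⟩ := exists_window_ccmShape (L := F.L) F.hL.2.le j N
  refine ⟨γ₀, hγ₀, fun γ c ε₀ ε₂₉ B₃ B₃' a₀ a₁ bl β' c₁₅ hc hc8 hε hε' hB hB' ha₀ ha₁ hγ hγle h15 hc₁₅ h9 hbox hbox' hl hβ' θ hθ h hsolv σ hσ hσB => ?_⟩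
  obtain ⟨hγe, h3γ, hRγ, hε3γ, hε2γ⟩ := hall γ hγ hγle
  exact thm1Printed_gaussPinH_ccmwCRH_of_supplierBorel_of_solvable_of_hjm hθ hjm hc hc8 hj hε hε' hB hB' ha₀ ha₁ hγ hγe h3γ hRγ hε3γ hε2γ h15 hc₁₅ h9 hbox hbox' hl hβ'
    h hsolv σ hσ hσB

/-- **★★★★ «γ SUFFICIENTLY SMALL» QUANTIFIED AT THE MEMBER's HISTORY-BLIND DOOR, KEY INCLUDED**: there is an explicit `γ₁₁ⁿᵘᵐ(L, j, N) > 0` such that for every `γ ∈ ]0, γ₁₁ⁿᵘᵐ]`,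
every `c ∈ [2, 8]`, [15]'s signs, (8), the (9)-step, the sign-free β-box, and — on the windowed runs — K0's per-cube [15]-solvability and a [III] §3 supplier, N11's PRINTED OUTPUT holds at
`gaussPinH (ofHistoryBlind ⟨θ₁₃(n_c, ε₂₉), ZrOfRecord₁₃ …⟩)` — NOTHING ELSE displayed: the conclusion is «the KEY holds there (this seat's g4 door theorem) ∧ for EVERY proof
`hG` of the key, `B16.Thm1Printed` at the datum keyed by `hG`» (dag-n11-w5's door-keyed ★★★★★ with the five γ-conditions supplied; proof-irrelevant in `hG`).  CONDITIONAL; nothing of Bałaban asserted; NOT a discharge.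
[cite: Balaban1988Convergent, Thm 1 p.262, Theorem p.245, §3 p.279, (2.4)–(2.5) p.255, (2.10) p.256, (2.28) p.259, (3.16)–(3.25) pp.268–270; Balaban1987RG1, Thm 1 p.259, (0.20) p.256, (1.20)–(1.22) p.264; Balaban1989LargeFieldII, Thm 1 p.355; Balaban1989LargeFieldI, (0.2)–(0.4) p.176; Balaban1985Variational, Thm 1 (7)–(9) pp.278–279, (144)–(152) pp.300–301, Prop. 8 p.304] -/
theorem exists_window_thm1Printed_gaussPinH_door_ccmwCR_of_betaBox (hj : 1 ≤ j) (hjm : j + 1 ≤ F.m) :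
    ∃ γ₀ : ℝ, 0 < γ₀ ∧ ∀ (γ c ε₀ ε₂₉ B₃ B₃' a₀ a₁ bl β' : ℝ) (c₁₅ : ℕ) (hc : 2 ≤ c) (hc8 : c ≤ 8) (hε : 0 < ε₀) (hε' : 0 < ε₂₉) (hB : 0 ≤ B₃) (hB' : 0 ≤ B₃')
      (ha₀ : 0 < a₀) (ha₁ : 0 < a₁) (hγ : 0 < γ) (hγle : γ ≤ γ₀) (h15 : VariationalThm1RegSepCoP7M F N B₃ a₀ a₁) (hc₁₅ : c₁₅ ≤ F.L ^ j)
      (h9 : Gauge9RegSepTopStepR F N (fun ν K Ω => suppDomOfRecord F ν K Ω) (F.L ^ j) c₁₅ B₃ B₃' a₀ a₁)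
      (hbox : BetaLowerH bl γ (betaOfRecord₁₃ F N (theta13OfThm1CCMW F N j γ ε₀ ε₂₉ B₃ B₃' a₀ a₁)))
      (hbox' : BetaUpperH β' γ (betaOfRecord₁₃ F N (theta13OfThm1CCMW F N j γ ε₀ ε₂₉ B₃ B₃' a₀ a₁))) (hl : -bl * γ ^ 2 ≤ 3) (hβ' : β' * γ ^ 2 ≤ 3 / 4)
      (θ₀ : Stage13Params F N) (hθ₀ : θ₀ = theta13LiveOfNumerics F N
          ({ stage12NumericsOfThm1CCMW F.L j γ ε₀ B₃ B₃' a₀ a₁ with s2 := { sect2NumericsOfThm1C F.L with cR := c } } : Stage12Numerics) ε₂₉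
          (zeta316OfRecord F N (stage12NumericsOfThm1CCMW F.L j γ ε₀ B₃ B₃' a₀ a₁).ν (stage12NumericsOfThm1CCMW F.L j γ ε₀ B₃ B₃' a₀ a₁).τ9.M
            (stage12NumericsOfThm1CCMW F.L j γ ε₀ B₃ B₃' a₀ a₁).A₁) (RzOfRecord F N) (ZtOfRecord F N)),
      (∀ P : B12.RunParams, Step.InInterval γ P.K (gOfRecord₁₃ F N θ₀ P) → ∀ i, 1 ≤ i → i ≤ P.K →
        ∀ (s : SeqOfRecord F θ₀.ν θ₀.τ9.M (gOfRecord₁₃ F N θ₀ P) P.K i) (V : GaugeField (F.P P.K) i (SU N)),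
        chiSeqOfRecord F N θ₀.ν θ₀.τ9.M (gOfRecord₁₃ F N θ₀ P) P.K i s V ≠ 0 →
        ∀ a ∈ cubesIn (fun a : ↥(cubeIndices (F.P P.K) (cubeSide (F.P P.K).L θ₀.ν.M₂ (RkOfRecord (F.P P.K).L θ₀.ν.r (gOfRecord₁₃ F N θ₀ P i)) i)) =>
            cubeEnl (F.P P.K) (cubeSide (F.P P.K).L θ₀.ν.M₂ (RkOfRecord (F.P P.K).L θ₀.ν.r (gOfRecord₁₃ F N θ₀ P i)) i) a 0) (s.Ω i),
          ∃ U₀, IsMinimizer (avOfRecord F N P.K) {U | PlaqSmall (θ₀.ν.εreg * (F.P P.K).eta i ^ 2) U}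
            (Bj θ₀.ν.M₁ (cubeEnl (F.P P.K) (cubeSide (F.P P.K).L θ₀.ν.M₂ (RkOfRecord (F.P P.K).L θ₀.ν.r (gOfRecord₁₃ F N θ₀ P i)) i) a 4) i)
            (avgFamily (avOfRecord F N P.K) (qsstarGIter0 i V)) U₀) →
      ∀ (σ : (P : B12.RunParams) → Sect3Supplier (gaussPinH (Stage13HParams.ofHistoryBlind F N ⟨θ₀, ZrOfRecord₁₃ F N θ₀⟩)) P),
      (∀ P : B12.RunParams, Step.InInterval γ P.K (gOfRecord₁₃ F N θ₀ P) → SupplierObligations (gaussPinH (Stage13HParams.ofHistoryBlind F N ⟨θ₀, ZrOfRecord₁₃ F N θ₀⟩)) P (σ P)) →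
      (∀ P : B12.RunParams, Step.InInterval γ P.K (gOfRecord₁₃ F N θ₀ P) → SupplierBorel (gaussPinH (Stage13HParams.ofHistoryBlind F N ⟨θ₀, ZrOfRecord₁₃ F N θ₀⟩)) P (σ P)) →
      (Stage13HParams.ofHistoryBlind F N ⟨θ₀, ZrOfRecord₁₃ F N θ₀⟩).Provisos₁₃SepCoPH F N ∧
      ∀ hG : (Stage13HParams.ofHistoryBlind F N ⟨θ₀, ZrOfRecord₁₃ F N θ₀⟩).Provisos₁₃SepCoPH F N,
        B16.Thm1Printed (datumOfRecord₁₃SepCoPH F N (gaussPinH (Stage13HParams.ofHistoryBlind F N ⟨θ₀, ZrOfRecord₁₃ F N θ₀⟩)) (provisos₁₃SepCoPH_gaussPinH hG)).C := by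
  obtain ⟨γ₀, hγ₀, hall⟩ := exists_window_ccmShape (L := F.L) F.hL.2.le j N
  refine ⟨γ₀, hγ₀, fun γ c ε₀ ε₂₉ B₃ B₃' a₀ a₁ bl β' c₁₅ hc hc8 hε hε' hB hB' ha₀ ha₁ hγ hγle h15 hc₁₅ h9 hbox hbox' hl hβ' θ₀ hθ₀ hsolv σ hσ hσB => ?_⟩
  obtain ⟨hγe, h3γ, hRγ, hε3γ, hε2γ⟩ := hall γ hγ hγle
  exact ⟨provisos₁₃SepCoPH_door_ccmwCR_of_gauge9TopStepR_of_betaBoxSignFree_allTorus hθ₀ (by linarith) hc8 hγ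
      (hγe.trans (Real.exp_neg_one_lt_d9.le.trans (by norm_num))) hε hε' hB hB' ha₀ ha₁ h15 hc₁₅ h9 hbox hbox' hl hβ',
    fun _ => thm1Printed_gaussPinH_door_ccmwCR_of_supplierBorel_of_solvable_of_hjm hθ₀ hjm hc hc8 hj hε hε' hB hB' ha₀ ha₁ hγ hγe h3γ hRγ hε3γ hε2γ h15 hc₁₅ h9
      hbox hbox' hl hβ' hsolv σ hσ hσB⟩

end Summit.QuantumFields.YangMills.Theorems.BalabanUVNodesN11Thm1PrintedAtCRLetteredMemberOfBgFactsWindow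

end
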